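import Summits.CriticalPhenomena.PercolationContinuityZ3.Theorems.PercNearOneGluingNoHeavyQuantTargetLemmaThin
import Summits.CriticalPhenomena.PercolationContinuityZ3.Theorems.PercNearOneGluingNoHeavyQuantChainsThin
import Summits.CriticalPhenomena.PercolationContinuityZ3.Theorems.PercNearOneGluingNoHeavyQuantFailBoundThin
import Literature.Probability.Percolation.KozmaNitzanTheorem6
import HarnessLib

/-!
# QUANT lane (R2.b, step S4b): Kozma–Nitzan's Theorem 6 in EFFECTIVE form — slab percolation at `p` from
# finite-volume inputs at `p` on a BOUNDED range of scales

builds on p205010 (kernel theorem, internal audit signed; external expert review pending)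

Cell `prim-quant` (post-continuity programme, LANE 1), seat `prim-quant-p2` (METHOD = effective Kozma–Nitzan
reduction), memo `run/shared/lean/prim/quant/P2-EFFECTIVE-KN.md` §2 (T6-eff).

The tree's `KozmaNitzan.exists_KSch_theta_slab_pos_of_target` (`…/KozmaNitzanTheorem6.lean`, KN §4 pp. 25–31)
derives "some slab percolates at `p`" from `TargetProperty d p` and `θ(p) > 0`, choosing every scale by a LIMIT.
`Quant.slabPerc_of_finiteSizeInputs` below re-runs the same assembly (`KSch.lawful`, `KSch.hQ0_of_hit`,
`KSch.theta_slab_pos`, and the thin failure bound `Quant.fail_bound_thin`) with: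
* the target lemma supplied by `Quant.targetLemma_thin` (additive gluing, explicit margin) for the quarter faces and —
  through `Quant.elongHit_thin` (Lemma 11, linear) — for the elongated boxes of aspects `2K`, `88`, `6`;
* Lemma 12 supplied by `Quant.corridorLemma_thin` (linear);
* ALL tolerances as explicit parameters tied by explicit polynomial inequalities (they depend on `d` and `K` only —
  no tower; memo §2), `K` any integer `≥ 20` with `(1 − δ₂)^K + ε/8 ≤ ε/4`, `ε = 2⁻³²`;
* ALL scales explicit: seed `n`, uniqueness-zone scale `M > n`, seed count `k`, margins `R₀ ≤ R₁`, stub increment `s`,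
  `r = K·s`, and the finite-volume inputs demanded only on the BOUNDED range of scales `[M, 5Ks]`:
  (U) `P_p(uniqZone n M) > 1 − τ`; (F) `P_p(Λ_n ↔ face orthant of Λ_{n'} in Λ_{n'}) > 1 − τ` for `n' ∈ [M, 5Ks]`;
  (Q) `P_p(Λ_n ↔ ℓF in ℓQ) > 1 − τ` for every quarter-face geometry and `ℓ ∈ [M, 5Ks]`.
Conclusion: the exploration scheme with cells `⟨K, s⟩` and threshold `δc` is lawful with failure rate `2⁻³²`, hence
`θ((ℤ^d)|slab)(p) > 0` for KN's slab `{|x_j| ≤ 5r, j ≥ 3}` (`KSch.theta_slab_pos`, explicit Peierls bound).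
No `TargetProperty`, no `IsHittable`, no `θ(p) > 0`, no limit.  At `p = p_c` the conclusion is false
(`theta_slab_criticalProbI_eq_zero_of_two_le`), so (U) ∧ (F) ∧ (Q) fails at every admissible choice of scales — the
scale defect consumed by `…QuantScaleDefectRate.lean`.  No definitions; no sorries; standard axioms.
[cite: KozmaNitzan2024, §4 Theorem 6 (pp. 25–31)]
-/

noncomputable section

namespace Summit.CriticalPhenomena.PercolationContinuityZ3.Theorems.Quant

open MeasureTheory Literature.Probability.LatticeModels Literature.Probability.Percolation
  Literature.Probability.Percolation.KozmaNitzan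
open Literature.Probability.Percolation.GadgetSystem Literature.Probability.Percolation.Contour

variable {d : ℕ}

/-- `TargetPropertyThinAt` is monotone in the output tolerance. [folklore] -/
theorem TargetPropertyThinAt.mono_eps {p : unitInterval} {ε ε' δ : ℝ} {H : List (Geom d)} {R w : ℕ}
    (h : TargetPropertyThinAt d p ε δ H R w) (hε : ε ≤ ε') : TargetPropertyThinAt d p ε' δ H R w :=
  fun W Sfin D lo hi T o a1 a2 a3 a4 a5 a6 a7 a8 a9 a10 a11 =>
    lt_of_le_of_lt (by linarith) (h W Sfin D lo hi T o a1 a2 a3 a4 a5 a6 a7 a8 a9 a10 a11)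

set_option maxHeartbeats 400000 in
/-- **Kozma–Nitzan's Theorem 6, EFFECTIVE: slab percolation at `p` from finite-volume inputs at `p` on a bounded
range of scales.**  Dimension `d ≥ 3`, parameter `0 < p < 1`.  Constants: `ε = 2⁻³²`; `K ≥ 20` and tolerances
`δ₂, δc` and `δt, δtq, δq, δe, δeq, δ6q ≥ δmin > 0`, `τ < δmin²`, tied by the displayed explicit inequalities
(`(1−δ₂)^K + ε/8 ≤ ε/4`, `δ₂ + 6δt ≤ δc ≤ 1`, `δc + 6dδq + 6δe ≤ ε/8`, `τ + (16K−4)·6δtq ≤ δt²`,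
`τ + 700·6δeq ≤ δe²`, `τ + 44·6δ6q ≤ δc`).  Scales: seed `n ≥ 1`, zone scale `M > n`, seed count `k` with
`(1 − p^{seedBound d M})^k ≤ δmin`, margins `R₀` (quarter faces) and `R₁` (elongated boxes of aspects `2K`, `88`),
stub increment `s ≥ max(2R₁, 100(d+1)(max R₀ R₁ + 1))` with `8(26 + 18R₀ + n + M) ≤ 3Ks`.  Inputs AT `p`:
(U) `1 − τ < P_p(uniqZone n M)`; (F) `1 − τ < P_p(linkEvent Λ_n (orthantFace a τ' n') n')` for all `n' ∈ [M, 5Ks]`;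
(Q) `1 − τ < P_p(linkIn (ℓQ_g) Λ_n (ℓF_g))` for all quarter-face geometries `g` and `ℓ ∈ [M, 5Ks]`.
Conclusion: for the scheme `S = ⟨⟨d, K, s⟩, p, δc⟩`, `0 < θ_{(ℤ^d)|S.slab}(p)` (KN's slab of half-width `5Ks`).
Proof: the tree's assembly with the target lemma, Lemma 11 and Lemma 12 replaced by their additive, explicit,
transversally-bounded versions (`targetLemma_thin`, `elongHit_thin`, `corridorLemma_thin`, `fail_bound_thin`).
builds on p205010 (kernel theorem, internal audit signed; external expert review pending).
[cite: KozmaNitzan2024, §4 Theorem 6 (pp. 25–31), Lemmas 10–12] -/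
theorem slabPerc_of_finiteSizeInputs (hd : 3 ≤ d) (p : unitInterval) (hp0 : 0 < (p : ℝ)) (hp1 : (p : ℝ) < 1)
    {K : ℕ} (hK20 : 20 ≤ K)
    {δ₂ δc δt δtq δq δe δeq δ6q δmin τ : ℝ}
    (hδ₂1 : δ₂ ≤ 1) (hδc1 : δc ≤ 1)
    (hKε : (1 - δ₂) ^ K + (1 / 2 : ℝ) ^ 32 / 8 ≤ (1 / 2 : ℝ) ^ 32 / 4)
    (hct : δ₂ + 6 * δt ≤ δc)
    (h12 : δc + (d : ℝ) * (6 * δq) + 6 * δe ≤ (1 / 2 : ℝ) ^ 32 / 8)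
    (htq : τ + ((8 * (2 * K) - 4 : ℕ) : ℝ) * (6 * δtq) ≤ δt ^ 2)
    (heq : τ + ((8 * 88 - 4 : ℕ) : ℝ) * (6 * δeq) ≤ δe ^ 2)
    (h6q : τ + ((8 * 6 - 4 : ℕ) : ℝ) * (6 * δ6q) ≤ δc)
    (hδmin0 : 0 < δmin) (hmin_t : δmin ≤ δt) (hmin_tq : δmin ≤ δtq) (hmin_q : δmin ≤ δq)
    (hmin_e : δmin ≤ δe) (hmin_eq : δmin ≤ δeq) (hmin_6q : δmin ≤ δ6q)
    (hτ : τ < δmin ^ 2)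
    {n M k R₀ R₁ s : ℕ} (hnM : n < M)
    (hk : (1 - (p : ℝ) ^ seedBound d M) ^ k ≤ δmin)
    (hR₀ : 3 * M + M + 4 + ⌈(1 / (1 - (p : ℝ)) ^ (2 * d * LData.Ncont d M k)) / δmin⌉₊ ≤ R₀)
    (hR₁a : 3 * M + 8 * (3 * (2 * K) + 3 * (2 * K) * R₀ + n + M + 8) + 4 +
      ⌈(1 / (1 - (p : ℝ)) ^ (2 * d * LData.Ncont d M k)) / δmin⌉₊ ≤ R₁)
    (hR₁b : 3 * M + 8 * (3 * 88 + 3 * 88 * R₀ + n + M + 8) + 4 +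
      ⌈(1 / (1 - (p : ℝ)) ^ (2 * d * LData.Ncont d M k)) / δmin⌉₊ ≤ R₁)
    (hs1 : 1 ≤ s) (hsR : 2 * R₁ ≤ s) (hs12 : 100 * (d + 1) * (max R₀ R₁ + 1) ≤ s)
    (hs6 : 8 * (3 * 6 + 3 * 6 * R₀ + n + M + 8) ≤ 3 * (K * s)) (hn3 : n ≤ 3 * (K * s))
    (huniq : 1 - τ < (bondPercolation (zdGraph d) p).real (uniqZone n M))
    (hface : ∀ n' : ℕ, M ≤ n' → n' ≤ 5 * (K * s) → ∀ (a : Fin d) (τ' : Fin d → ℤˣ),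
      1 - τ < (bondPercolation (zdGraph d) p).real (linkEvent (box d n) (orthantFace a τ' n') n'))
    (hqf : ∀ g ∈ qfList d, ∀ ℓ : ℕ, M ≤ ℓ → ℓ ≤ 5 * (K * s) →
      1 - τ < (bondPercolation (zdGraph d) p).real (linkIn (↑(g.Qset ℓ 0)) (box d n) (g.Fset ℓ 0))) :
    ∃ S : KSch d, S.p = p ∧ S.C.K = K ∧ S.C.s = s ∧ S.δc = δc ∧
      0 < theta ((zdGraph d).induce S.slab) ⟨0, S.zero_mem_slab⟩ p := by
  classical
  haveI : NeZero d := ⟨by omega⟩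
  set ε : ℝ := (1 / 2 : ℝ) ^ 32 with hε
  have hε0 : 0 < ε := by positivity
  set W : ℕ := 5 * (K * s) with hW
  -- tolerance bookkeeping
  have hsq : ∀ δx : ℝ, δmin ≤ δx → τ < δx ^ 2 := fun δx hx =>
    hτ.trans_le (pow_le_pow_left₀ hδmin0.le hx 2)
  have hceil : ∀ δx : ℝ, δmin ≤ δx →
      ⌈(1 / (1 - (p : ℝ)) ^ (2 * d * LData.Ncont d M k)) / δx⌉₊ ≤
        ⌈(1 / (1 - (p : ℝ)) ^ (2 * d * LData.Ncont d M k)) / δmin⌉₊ := fun δx hx =>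
    Nat.ceil_mono (div_le_div_of_nonneg_left (by positivity) hδmin0 hx)
  -- arithmetic on the scales
  have hMR₀ : M ≤ R₀ := by omega
  have hMs : M ≤ s := by
    have : max R₀ R₁ + 1 ≤ 100 * (d + 1) * (max R₀ R₁ + 1) := Nat.le_mul_of_pos_left _ (by positivity)
    have : R₀ ≤ max R₀ R₁ := le_max_left _ _
    omega
  have hsKs : s ≤ K * s := Nat.le_mul_of_pos_left s (by omega)
  have hMW : M ≤ W := by rw [hW]; nlinarith
  -- (1) the quarter-face families (thin target property, margin `R₀`, half-width `W`)
  have famQ : ∀ δx : ℝ, δmin ≤ δx → ∀ δ' : ℝ, TargetPropertyThinAt d p (δ' + 6 * δx) δ' (qfList d) R₀ W := by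
    intro δx hx δ'
    have hδx : 0 < δx := hδmin0.trans_le hx
    have hτx := hsq δx hx
    refine targetLemma_thin p hp1 hδx (qfList d) (wideList_qfList (by omega)) (ℓmax := M) hnM
      (fun g hg ℓ h1 h2 => ?_) (fun a τ' => ?_) ?_ (hk.trans hx) ?_ δ'
    · exact lt_of_le_of_lt (by linarith) (hqf g hg ℓ h1 h2)
    · exact lt_of_le_of_lt (by linarith) (hface M le_rfl hMW a τ')
    · exact lt_of_le_of_lt (by linarith) huniq
    · have := hceil δx hx; omega
  -- (2) elongated boxes are hit (Lemma 11, linear) for aspects `K' ≥ 2`, from the family at tolerance `δx`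
  have hitE : ∀ (K' : ℕ) (hK' : 2 ≤ K') (δx : ℝ), δmin ≤ δx → ∀ {r' m' : ℕ},
      8 * (3 * K' + 3 * K' * R₀ + n + M + 8) ≤ r' → r' ≤ W → n ≤ m' → ∀ (a : Fin d) (σ : ℤˣ),
      1 - (τ + ((8 * K' - 4 : ℕ) : ℝ) * (6 * δx)) < (bondPercolation (zdGraph d) p).real
        (linkIn (↑((elongGeom a σ K' (by omega)).Qset r' 0)) (box d m')
          ((elongGeom a σ K' (by omega)).Fset r' 0)) := by
    intro K' hK' δx hx r' m' hr hrW hm a σ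
    exact elongHit_thin p (famQ δx hx) a σ K' hK' (k := n) (n₁ := M) (r := r') (m := m') hrW
      (fun n' h1 h2 a' τ' => hface n' h1 (h2.trans hrW) a' τ') hr hm
  -- (3) the elongated families of aspects `2K` (tolerance `δt`) and `88` (tolerance `δe`), margin `R₁`
  have hK2 : 2 ≤ 2 * K := by omega
  have famT : ∀ δ' : ℝ, TargetPropertyThinAt d p (δ' + 6 * δt) δ' (elongList d (2 * K) (by omega)) R₁ W := by
    intro δ'
    have hδt : 0 < δt := hδmin0.trans_le hmin_t
    have hτt := hsq δt hmin_t
    refine targetLemma_thin p hp1 hδt _ (wideList_elongList hd _ _)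
      (ℓmax := 8 * (3 * (2 * K) + 3 * (2 * K) * R₀ + n + M + 8)) hnM
      (fun g hg ℓ h1 h2 => ?_) (fun a τ' => ?_) ?_ (hk.trans hmin_t) ?_ δ'
    · rw [elongList, List.mem_map] at hg
      obtain ⟨x, -, rfl⟩ := hg
      exact lt_of_le_of_lt (by linarith) (hitE (2 * K) hK2 δtq hmin_tq h1 h2 le_rfl x.1 x.2)
    · exact lt_of_le_of_lt (by linarith) (hface M le_rfl hMW a τ')
    · exact lt_of_le_of_lt (by linarith) huniq
    · have := hceil δt hmin_t; omega
  have famE : ∀ δ' : ℝ, TargetPropertyThinAt d p (δ' + 6 * δe) δ' (elongList d 88 (by norm_num)) R₁ W := by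
    intro δ'
    have hδe : 0 < δe := hδmin0.trans_le hmin_e
    have hτe := hsq δe hmin_e
    refine targetLemma_thin p hp1 hδe _ (wideList_elongList hd _ _)
      (ℓmax := 8 * (3 * 88 + 3 * 88 * R₀ + n + M + 8)) hnM
      (fun g hg ℓ h1 h2 => ?_) (fun a τ' => ?_) ?_ (hk.trans hmin_e) ?_ δ'
    · rw [elongList, List.mem_map] at hg
      obtain ⟨x, -, rfl⟩ := hg
      exact lt_of_le_of_lt (by linarith) (hitE 88 (by norm_num) δeq hmin_eq h1 h2 le_rfl x.1 x.2)
    · exact lt_of_le_of_lt (by linarith) (hface M le_rfl hMW a τ')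
    · exact lt_of_le_of_lt (by linarith) huniq
    · have := hceil δe hmin_e; omega
  -- (4) the scheme
  set C : Cells d := ⟨hd, K, s, hK20, hs1⟩ with hCdef
  set S : KSch d := ⟨C, p, δc⟩ with hSdef
  refine ⟨S, rfl, rfl, rfl, rfl, ?_⟩
  have hCr : C.r = K * s := rfl
  have hL : S.scheme.Lawful (zdGraph d) p ε := by
    refine S.lawful (fun du => ?_) (fun h e hV => ?_)
    · -- (32) at the origin: the aspect-6 box is hit from `Λ_{3r}` at scale `3r`
      refine S.hQ0_of_hit du (lt_of_le_of_lt ?_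
        (hitE 6 (by norm_num) δ6q hmin_6q (r' := 3 * C.r) (m' := 3 * C.r) ?_ ?_ ?_ (C.axOf du) (σu du)))
      · show 1 - δc ≤ 1 - (τ + ((8 * 6 - 4 : ℕ) : ℝ) * (6 * δ6q)); linarith
      · rw [hCr]; exact hs6
      · rw [hCr, hW]; omega
      · rw [hCr]; exact hn3
    · refine fail_bound_thin hV hε0.le hδ₂1 (R := R₁) (fun T hT hTr hyp => ?_) ?_ hsR hKε
      · -- Lemma 12, linear, in the weighting of the corridor datum `T` (`T.r = C.r = Ks`)
        have hTr' : T.r = K * s := by rw [hTr]; rfl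
        have hc := corridorLemma_thin p (famQ δq hmin_q) famE T hT (wth := W) (by rw [hTr', hW])
          (by rw [hTr']; exact le_trans hs12 hsKs) (δ' := δc) hyp
        refine lt_of_le_of_lt ?_ hc
        show 1 - ε / 8 ≤ 1 - (δc + (d : ℝ) * (6 * δq) + 6 * δe)
        linarith
      · -- the target lemma for the aspect-`2K` boxes, thin, at (`δc`, `δ₂`)
        show TargetPropertyThinAt d p δc δ₂ (elongList d (2 * K) _) R₁ (5 * (K * s))
        exact (famT δ₂).mono_eps hct
  exact S.theta_slab_pos hL le_rfl hp0 hδc1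

end Summit.CriticalPhenomena.PercolationContinuityZ3.Theorems.Quant

end
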